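import Literature.Probability.Percolation.QuantitativeGMRun
import Literature.Probability.Percolation.QuantitativeGMConnections
import Mathlib.Analysis.SpecialFunctions.Pow.Real
import Mathlib.Analysis.Complex.ExponentialBounds
import HarnessLib

/-!
# DKT 2020, Theorem 7 (quantitative Grimmett–Marstrand): `p_c ≤ p + Cε` from (a), (b), (c)

Topic `Literature/Probability/Percolation`. Proof file (theorems only) assembling Theorem 7 of

* H. Duminil-Copin, G. Kozma, V. Tassion, *Upper bounds on the percolation correlation length*,
  Progr. Probab. 77 (2020) = arXiv:1902.03207 [DuminilcopinKozmaTassion2020], §5,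

in the form needed for Theorem 2 (`p < p_c`, §6: "at `p_n + C/√(log n)` we already have percolation
in a slab, and in particular it is above `p_c`"): **if at density `p ∈ [p_lo, p_hi] ⊂ (0,1)`,
parameter `ε` (small in terms of `d`, `p_lo`, `p_hi` — an explicit inequality `hsmall`) and scales
`k ≤ K`, `10K ≤ ε² n`, `n < N` the conditions (a) `ℙ_p[0 ↔ ∂Λ_N] ≥ ε`,
(b) `ℙ_p[Λ_k ↔ ∂Λ_N in Λ_N] ≥ 1 − e^{−1/ε}`, (c) `ℙ_p[A₂(k,K)], ℙ_p[A₂(n,N)] ≤ e^{−1/ε}` hold, then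
`p_c(ℤ^d) ≤ p + C ε`** with `C = 1000 κ log(1/(1-p_hi))/p_lo`, `κ = 2^d d!` (`thm7_criticalProb_le`).

Proof = Lemma 8 (`QuantitativeGMConnections.lean`, giving the sphere-meeting finite-size criterion
with margin `η ≤ 3e^{-1/ε} + (2ε^{-2} + 2) e^{-1/(κε)}` for `ℓ = ⌈2/ε²⌉` points) fed into the tree's
Martineau–Tassion run of the Grimmett–Marstrand renormalisation
(`QuantitativeGMRun.criticalProb_le_sprinkleParam_of_sphereFC`), with the sprinkling chosen as in
DKT's Lemma 10: the reserve layers carry `r + 1` coins with `x = p^{r+1} ∈ [10Λκε, 10Λκε/p_lo)`,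
`Λ = log(1/(1-p_hi))`, and `t = ⌈5/x⌉`, so that the failure bound
`η (1-p)^{-t} + (1 - p^{r+1})^t ≤ η e^{1/(2κε)}/(1-p_hi) + e^{-5} ≤ 1/64` and the sprinkled density is
`≤ p + 100 p^{r+1} ≤ p + Cε`. The smallness inequality on `ε` is discharged asymptotically in
`eventually_smallness` (for the user, who lets `ε = 1/√(log n) → 0`).

## References

* H. Duminil-Copin, G. Kozma, V. Tassion, arXiv:1902.03207, §5 (Theorem 7, Lemmas 8–10), §6.
* S. Martineau, V. Tassion, Ann. Probab. 45 (2017), §4 [MartineauTassion2017].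
-/

noncomputable section

namespace Literature.Probability.Percolation

namespace DKT20

open MeasureTheory Filter LatticeModels DCT16 GM GMStep
open scoped Topology

variable {d : ℕ}

/-! ## §1. Elementary inequalities -/

/-- `e^{-1/ε} ≤ ε/2` for `ε > 0` (from `e^y ≥ 1 + y + y²/2 > 2y`). [folklore] -/
theorem exp_neg_inv_le_half {ε : ℝ} (hε : 0 < ε) : Real.exp (-(1 / ε)) ≤ ε / 2 := by
  have hy : 0 ≤ 1 / ε := by positivity
  have h1 : 1 + 1 / ε + (1 / ε) ^ 2 / 2 ≤ Real.exp (1 / ε) := Real.quadratic_le_exp_of_nonneg hy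
  have h2 : 2 * (1 / ε) ≤ Real.exp (1 / ε) := by nlinarith [sq_nonneg (1 / ε - 1)]
  rw [Real.exp_neg]
  rw [inv_le_comm₀ (Real.exp_pos _) (by positivity)]
  calc (ε / 2)⁻¹ = 2 * (1 / ε) := by field_simp
    _ ≤ Real.exp (1 / ε) := h2

/-- `(1 - a)^k ≤ e^{-k a}` for `a ≤ 1`. [folklore] -/
theorem one_sub_pow_le_exp_neg_mul {a : ℝ} (ha : a ≤ 1) (k : ℕ) :
    (1 - a) ^ k ≤ Real.exp (-(k * a)) := by
  have h1 : 1 - a ≤ Real.exp (-a) := Real.one_sub_le_exp_neg a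
  calc (1 - a) ^ k ≤ Real.exp (-a) ^ k := pow_le_pow_left₀ (by linarith) h1 k
    _ = Real.exp (-(k * a)) := by rw [← Real.exp_nat_mul]; ring_nf

/-- `e^{-5} ≤ 1/128`. [folklore] -/
theorem exp_neg_five_le : Real.exp (-5) ≤ 1 / 128 := by
  rw [Real.exp_neg, inv_le_comm₀ (Real.exp_pos _) (by norm_num)]
  have h := Real.exp_one_gt_d9
  have h5 : Real.exp 5 = Real.exp 1 ^ 5 := by rw [← Real.exp_nat_mul]; norm_num
  rw [h5]
  have : (1 / 128 : ℝ)⁻¹ = 128 := by norm_num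
  rw [this]
  nlinarith [pow_le_pow_left₀ (by norm_num : (0:ℝ) ≤ 2.7182818283) h.le 5]

/-- **A power of `p` in a prescribed window**: for `0 < p_lo ≤ p < 1` and `0 < T < 1` there is
`m ≥ 1` with `p_lo T ≤ p^m < T` (the least `m` with `p^m < T`). Used to choose the number of coins
per reserve layer (`x = p^{r+1} ≍ λε`, DKT's Lemma 10: "Choosing `λ` large enough"). [folklore] -/
theorem exists_pow_mem_window {p p_lo T : ℝ} (hlo : 0 < p_lo) (hlop : p_lo ≤ p) (hp1 : p < 1)
    (hT0 : 0 < T) (hT1 : T < 1) : ∃ m : ℕ, 1 ≤ m ∧ p ^ m < T ∧ p_lo * T ≤ p ^ m := by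
  classical
  have hp0 : 0 < p := hlo.trans_le hlop
  have hex : ∃ m : ℕ, p ^ m < T := by
    obtain ⟨m, hm⟩ := exists_pow_lt_of_lt_one hT0 hp1
    exact ⟨m, hm⟩
  refine ⟨Nat.find hex, ?_, Nat.find_spec hex, ?_⟩
  · by_contra h
    have h0 : Nat.find hex = 0 := by omega
    have := Nat.find_spec hex
    rw [h0, pow_zero] at this
    linarith
  · have hm0 : Nat.find hex ≠ 0 := by
      intro h0
      have := Nat.find_spec hex
      rw [h0, pow_zero] at this
      linarith
    obtain ⟨m', hm'⟩ := Nat.exists_eq_succ_of_ne_zero hm0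
    have hmin : ¬p ^ m' < T := Nat.find_min hex (by omega)
    push Not at hmin
    rw [hm', pow_succ]
    calc p_lo * T ≤ p * T := mul_le_mul_of_nonneg_right hlop hT0.le
      _ ≤ p * p ^ m' := mul_le_mul_of_nonneg_left hmin hp0.le
      _ = p ^ m' * p := mul_comm _ _

/-- **The smallness inequality holds for every small `ε`** (as `y = 1/ε → ∞`,
`(3e^{-y} + (2y² + 2) e^{-y/κ}) e^{y/(2κ)} → 0`). [folklore] -/
theorem eventually_smallness {κ : ℝ} (hκ : 1 ≤ κ) {c : ℝ} (hc : 0 < c) :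
    ∃ y₀ : ℝ, ∀ y, y₀ ≤ y →
      (3 * Real.exp (-y) + (2 * y ^ 2 + 2) * Real.exp (-(y / κ))) * Real.exp (y / (2 * κ)) ≤ c := by
  have hκ0 : 0 < κ := by linarith
  -- in the variable `s = y/(2κ) → ∞`: the expression is `3 e^{-(2κ-1)s}·… ≤ 3 e^{-s} + (8κ² s² + 2) e^{-s}`
  have h2 : Tendsto (fun s : ℝ => s ^ 2 * Real.exp (-s)) atTop (𝓝 0) := Real.tendsto_pow_mul_exp_neg_atTop_nhds_zero 2
  have h0 : Tendsto (fun s : ℝ => s ^ 0 * Real.exp (-s)) atTop (𝓝 0) := Real.tendsto_pow_mul_exp_neg_atTop_nhds_zero 0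
  have hsum : Tendsto (fun s : ℝ => 5 * (s ^ 0 * Real.exp (-s)) + 8 * κ ^ 2 * (s ^ 2 * Real.exp (-s))) atTop (𝓝 0) := by
    have := (h0.const_mul 5).add (h2.const_mul (8 * κ ^ 2))
    simpa using this
  have hev := hsum.eventually (gt_mem_nhds hc)
  obtain ⟨s₀, hs₀⟩ := hev.exists_forall_of_atTop
  refine ⟨max (2 * κ * s₀) 0, fun y hy => ?_⟩
  have hy0 : 0 ≤ y := le_of_max_le_right hy
  set s := y / (2 * κ) with hs
  have hsy : y = 2 * κ * s := by rw [hs]; field_simp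
  have hs₀s : s₀ ≤ s := by
    rw [hs, le_div_iff₀ (by positivity)]
    have := le_of_max_le_left hy; linarith
  have hs0 : 0 ≤ s := by rw [hs]; positivity
  have key := hs₀ s hs₀s
  simp only [pow_zero, one_mul] at key
  -- compare termwise
  have hA : 3 * Real.exp (-y) * Real.exp (y / (2 * κ)) ≤ 3 * Real.exp (-s) := by
    rw [mul_assoc, ← Real.exp_add]
    refine mul_le_mul_of_nonneg_left (Real.exp_le_exp.2 ?_) (by norm_num)
    rw [← hs, hsy]
    nlinarith
  have hB : (2 * y ^ 2 + 2) * Real.exp (-(y / κ)) * Real.exp (y / (2 * κ)) ≤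
      2 * Real.exp (-s) + 8 * κ ^ 2 * (s ^ 2 * Real.exp (-s)) := by
    rw [mul_assoc, ← Real.exp_add]
    have he : -(y / κ) + y / (2 * κ) = -s := by rw [hs]; field_simp; ring
    rw [he, hsy]
    have : (2 * (2 * κ * s) ^ 2 + 2) * Real.exp (-s) = 2 * Real.exp (-s) + 8 * κ ^ 2 * (s ^ 2 * Real.exp (-s)) := by
      ring
    rw [this]
  calc (3 * Real.exp (-y) + (2 * y ^ 2 + 2) * Real.exp (-(y / κ))) * Real.exp (y / (2 * κ))
      = 3 * Real.exp (-y) * Real.exp (y / (2 * κ)) +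
          (2 * y ^ 2 + 2) * Real.exp (-(y / κ)) * Real.exp (y / (2 * κ)) := by ring
    _ ≤ 3 * Real.exp (-s) + (2 * Real.exp (-s) + 8 * κ ^ 2 * (s ^ 2 * Real.exp (-s))) := add_le_add hA hB
    _ = 5 * Real.exp (-s) + 8 * κ ^ 2 * (s ^ 2 * Real.exp (-s)) := by ring
    _ ≤ c := key.le

/-! ## §2. Theorem 7: `p_c ≤ p + Cε` from (a), (b), (c) -/

/-- A vertex at sup-distance `ρ` from the origin lies on the sphere `∂Λ_ρ` (`d ≥ 1`). [folklore] -/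
theorem mem_innerBoundary_of_supDist_eq (P : GMParams) {v : Site P.d} {ρ : ℕ} (h : P.supDist 0 v = ρ) :
    v ∈ innerBoundary (zdGraph P.d) (box P.d ρ) := by
  unfold GMParams.supDist at h
  simp only [Pi.zero_apply, sub_zero] at h
  have hle : ∀ j, (v j).natAbs ≤ ρ := fun j => by
    rw [← h]; exact Finset.le_sup (f := fun j => (v j).natAbs) (Finset.mem_univ j)
  have hbox : v ∈ box P.d ρ := by
    rw [mem_box]; intro j; have := hle j; omega
  have hne : (Finset.univ : Finset (Fin P.d)).Nonempty := ⟨⟨0, by have := P.three_le; omega⟩, Finset.mem_univ _⟩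
  obtain ⟨j, -, hj⟩ := Finset.exists_mem_eq_sup Finset.univ hne fun j => (v j).natAbs
  refine mem_innerBoundary_of_abs_eq hbox (i := j) ?_
  rw [Int.abs_eq_natAbs, ← hj, h]

/-- **The scales fit**: with `ℓ = ⌈2/ε²⌉` points, `ℓ(2K+1) + K ≤ n` as soon as `10K ≤ ε²n`
(`K ≥ 1`, `ε ≤ 1`). [cite: DuminilcopinKozmaTassion2020, §5.1 ("we may choose ℓ ≥ c₁/ε² such points")] -/
theorem scales_fit {ε : ℝ} (hε0 : 0 < ε) (hε1 : ε ≤ 1) {K n : ℕ} (hK1 : 1 ≤ K)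
    (hKn : 10 * (K : ℝ) ≤ ε ^ 2 * n) : ⌈2 / ε ^ 2⌉₊ * (2 * K + 1) + K ≤ n := by
  set w : ℝ := 1 / ε ^ 2 with hw
  have hε2 : 0 < ε ^ 2 := by positivity
  have hw1 : 1 ≤ w := by
    rw [hw, le_div_iff₀ hε2]; nlinarith
  have h2w : 2 / ε ^ 2 = 2 * w := by rw [hw]; ring
  set ℓ : ℕ := ⌈2 / ε ^ 2⌉₊ with hℓ
  have hℓle : (ℓ : ℝ) < 2 * w + 1 := by
    rw [hℓ, h2w]; exact Nat.ceil_lt_add_one (by positivity)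
  have hKreal : (1 : ℝ) ≤ K := by exact_mod_cast hK1
  have hKn_real : 10 * (K : ℝ) * w ≤ n := by
    calc 10 * (K : ℝ) * w = 10 * K / ε ^ 2 := by rw [hw]; ring
      _ ≤ (n : ℝ) := by rw [div_le_iff₀ hε2]; linarith
  have hscale_real : (ℓ : ℝ) * (2 * K + 1) + K ≤ n := by
    have h3 : (2 * (K : ℝ) + 1) ≤ 3 * K := by linarith
    have hℓ0 : (0 : ℝ) ≤ ℓ := Nat.cast_nonneg ℓ
    calc (ℓ : ℝ) * (2 * K + 1) + K ≤ (2 * w + 1) * (3 * K) + K := by nlinarith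
      _ = 6 * K * w + 4 * K := by ring
      _ ≤ 6 * K * w + 4 * K * w := by nlinarith
      _ = 10 * K * w := by ring
      _ ≤ (n : ℝ) := hKn_real
  exact_mod_cast hscale_real

/-- **The margin of Lemma 8 is small**: with `q = e^{-1/ε}`, `ℓ = ⌈2/ε²⌉`, `0 < ε ≤ 1`, `κ ≥ 1`,
`(1 − (ε − q))^ℓ + (ℓ + 1) q^{1/κ} + 2q ≤ 3e^{−1/ε} + (2ε^{−2} + 2) e^{−1/(κε)}`
(DKT 2020 §5.1: `1 − (1−ε/2)^ℓ ≥ 1 − 2e^{−c₃/ε}` and `ℓ e^{−1/(d2^dε)} ≤ e^{−c/ε}`).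
[cite: DuminilcopinKozmaTassion2020, §5.1 (proof of Lemma 8)] -/
theorem margin_le {ε κ : ℝ} (hε0 : 0 < ε) (hε1 : ε ≤ 1) (hκ1 : 1 ≤ κ) :
    (1 - (ε - Real.exp (-(1 / ε)))) ^ ⌈2 / ε ^ 2⌉₊ +
        (⌈2 / ε ^ 2⌉₊ + 1) * Real.exp (-(1 / ε)) ^ κ⁻¹ + Real.exp (-(1 / ε)) + Real.exp (-(1 / ε)) ≤
      3 * Real.exp (-(1 / ε)) + (2 * (1 / ε) ^ 2 + 2) * Real.exp (-((1 / ε) / κ)) := by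
  have hκ0 : 0 < κ := by linarith
  set q : ℝ := Real.exp (-(1 / ε)) with hq
  have hq0 : 0 < q := Real.exp_pos _
  have hqε : q ≤ ε / 2 := exp_neg_inv_le_half hε0
  set w : ℝ := 1 / ε ^ 2 with hw
  have h2w : 2 / ε ^ 2 = 2 * w := by rw [hw]; ring
  set ℓ : ℕ := ⌈2 / ε ^ 2⌉₊ with hℓ
  have hℓge : 2 * w ≤ ℓ := by rw [hℓ, h2w]; exact Nat.le_ceil _
  have hℓle : (ℓ : ℝ) < 2 * w + 1 := by rw [hℓ, h2w]; exact Nat.ceil_lt_add_one (by positivity)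
  have hqκ : q ^ κ⁻¹ = Real.exp (-((1 / ε) / κ)) := by
    rw [hq, ← Real.exp_mul]; congr 1; field_simp
  have htermA : (1 - (ε - q)) ^ ℓ ≤ q := by
    have h0 : 0 ≤ 1 - (ε - q) := by linarith
    have h1 : 1 - (ε - q) ≤ 1 - ε / 2 := by linarith
    have hwε : 2 * w * (ε / 2) = 1 / ε := by rw [hw]; field_simp
    have hkey : 1 / ε ≤ (ℓ : ℝ) * (ε / 2) := by nlinarith
    calc (1 - (ε - q)) ^ ℓ ≤ (1 - ε / 2) ^ ℓ := pow_le_pow_left₀ h0 h1 ℓ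
      _ ≤ Real.exp (-(ℓ * (ε / 2))) := one_sub_pow_le_exp_neg_mul (by linarith) ℓ
      _ ≤ q := by rw [hq]; exact Real.exp_le_exp.2 (neg_le_neg hkey)
  have hB : ((ℓ : ℝ) + 1) * q ^ κ⁻¹ ≤ (2 * (1 / ε) ^ 2 + 2) * Real.exp (-((1 / ε) / κ)) := by
    rw [hqκ]
    refine mul_le_mul_of_nonneg_right ?_ (Real.exp_pos _).le
    have : (1 / ε) ^ 2 = w := by rw [hw]; ring
    rw [this]; linarith
  linarith

/-- **The failure bound of the run** (DKT 2020, Lemma 10: "Choosing `λ = λ(δ, ·)` large enough, the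
result follows by optimizing on `t`"): with margin `η ≤ η₀`, `η₀ e^{1/(2κε)} ≤ (1−p_hi)/128`,
sprinkling mass `x = p^{r+1} ∈ [10Λκε, 1]` (`Λ = log(1/(1−p_hi))`) and `t = ⌈5/x⌉`,
`η (1−p)^{−t} + (1 − x)^t ≤ 1/64`. [cite: DuminilcopinKozmaTassion2020, Lemma 10] -/
theorem failure_le {p p_hi κ ε η η₀ x : ℝ} {t : ℕ} (hphi : p ≤ p_hi) (hhi0 : 0 < p_hi) (hhi : p_hi < 1)
    (hκ0 : 0 < κ)
    (hε0 : 0 < ε) (hη0 : 0 ≤ η) (hηη₀ : η ≤ η₀)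
    (hsmall : η₀ * Real.exp ((1 / ε) / (2 * κ)) ≤ (1 - p_hi) / 128)
    (hx0 : 0 < x) (hx1 : x ≤ 1) (hxlo : 10 * (-Real.log (1 - p_hi)) * κ * ε ≤ x)
    (htge : 5 / x ≤ t) (htle : (t : ℝ) < 5 / x + 1) :
    η / (1 - p) ^ t + (1 - x) ^ t ≤ 1 / 64 := by
  set Λ : ℝ := -Real.log (1 - p_hi) with hΛ
  have h1phi : 0 < 1 - p_hi := by linarith
  have hΛ0 : 0 < Λ := by rw [hΛ, neg_pos]; exact Real.log_neg h1phi (by linarith)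
  -- `(1 - x)^t ≤ e^{-5} ≤ 1/128`
  have hfailA : (1 - x) ^ t ≤ 1 / 128 := by
    have step1 : (1 - x) ^ t ≤ Real.exp (-(t * x)) := one_sub_pow_le_exp_neg_mul hx1 t
    have step2 : Real.exp (-(t * x)) ≤ Real.exp (-5) := by
      refine Real.exp_le_exp.2 (neg_le_neg ?_)
      exact (div_le_iff₀ hx0).1 htge
    exact step1.trans (step2.trans exp_neg_five_le)
  -- `(1-p)^t ≥ (1-p_hi) e^{-1/(2κε)}`
  have hpow : (1 - p_hi) * Real.exp (-((1 / ε) / (2 * κ))) ≤ (1 - p) ^ t := by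
    have hle1 : (1 - p_hi) ^ t ≤ (1 - p) ^ t := pow_le_pow_left₀ h1phi.le (by linarith) t
    refine le_trans ?_ hle1
    have hexp : (1 - p_hi) ^ t = Real.exp (t * Real.log (1 - p_hi)) := by
      rw [Real.exp_nat_mul, Real.exp_log h1phi]
    have hlog : Real.log (1 - p_hi) = -Λ := by rw [hΛ, neg_neg]
    have h1mp : 1 - p_hi = Real.exp (-Λ) := by rw [hΛ, neg_neg, Real.exp_log h1phi]
    rw [hexp, hlog, h1mp, ← Real.exp_add]
    refine Real.exp_le_exp.2 ?_
    -- `-Λ - 1/(2κε) ≤ -t Λ`, from `t ≤ 5/x + 1` and `5Λ/x ≤ 1/(2κε)`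
    have h5 : 5 * Λ / x ≤ (1 / ε) / (2 * κ) := by
      rw [div_le_div_iff₀ hx0 (by positivity)]
      have h' : 5 * Λ * (2 * κ) * ε ≤ x := by rw [hΛ]; linarith
      calc 5 * Λ * (2 * κ) = 5 * Λ * (2 * κ) * ε * (1 / ε) := by field_simp
        _ ≤ x * (1 / ε) := mul_le_mul_of_nonneg_right h' (by positivity)
        _ = 1 / ε * x := mul_comm _ _
    have htΛ : (t : ℝ) * Λ ≤ 5 * Λ / x + Λ := by
      have := mul_le_mul_of_nonneg_right htle.le hΛ0.le
      calc (t : ℝ) * Λ ≤ (5 / x + 1) * Λ := this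
        _ = 5 * Λ / x + Λ := by ring
    linarith
  have hden : 0 < (1 - p_hi) * Real.exp (-((1 / ε) / (2 * κ))) := by positivity
  have hfailB : η / (1 - p) ^ t ≤ 1 / 128 := by
    calc η / (1 - p) ^ t ≤ η / ((1 - p_hi) * Real.exp (-((1 / ε) / (2 * κ)))) :=
          div_le_div_of_nonneg_left hη0 hden hpow
      _ ≤ η₀ / ((1 - p_hi) * Real.exp (-((1 / ε) / (2 * κ)))) :=
          div_le_div_of_nonneg_right hηη₀ hden.le
      _ = η₀ * Real.exp ((1 / ε) / (2 * κ)) / (1 - p_hi) := by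
          rw [Real.exp_neg]; field_simp
      _ ≤ ((1 - p_hi) / 128) / (1 - p_hi) := div_le_div_of_nonneg_right hsmall h1phi.le
      _ = 1 / 128 := by field_simp
  linarith

/-- **DKT 2020, Theorem 7, in the form "`p_c ≤ p + Cε`".** Fix `d ≥ 3`, a density `p` with
`0 < p_lo ≤ p ≤ p_hi < 1`, a parameter `0 < ε ≤ 1` satisfying the explicit smallness inequalities
`hsmallT`, `hsmall` (true for all `ε ≤ ε₀(d, p_lo, p_hi)`, see `eventually_smallness`), and scales
`k ≤ K`, `1 ≤ K`, `10 K ≤ ε² n`, `n < N`. If (a) `ℙ_p[0 ↔ ∂Λ_N] ≥ ε`, (b)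
`ℙ_p[Λ_k ↔ ∂Λ_N in Λ_N] ≥ 1 − e^{−1/ε}`, (c) `ℙ_p[uniqZone k Kᶜ] ≤ e^{−1/ε}` and
`ℙ_p[uniqZone n Nᶜ] ≤ e^{−1/ε}`, then `p_c(ℤ^d) ≤ p + 1000 κ log(1/(1−p_hi)) p_lo^{-1} ε`, `κ = 2^d d!`.
Printed: "Then `ℙ_{p+Cε}[0 ↔_{Slab_{2N}} ∞] ≥ ε/2`" — of which we keep the consequence used in §6
("in particular it is above `p_c`"): Lemma 8 (`lemma8`, with `ℓ = ⌈2/ε²⌉` points) gives the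
sphere-meeting finite-size criterion with margin `η ≤ 3e^{−1/ε} + (2ε^{−2}+2)e^{−1/(κε)}`
(`margin_le`); the Martineau–Tassion run (`criticalProb_le_sprinkleParam_of_sphereFC`) with `r + 1`
coins per reserve layer, `x = p^{r+1} ∈ [10Λκε, 10Λκε/p_lo)` (`exists_pow_mem_window`), and
`t = ⌈5/x⌉` has failure bound `≤ 1/64` (`failure_le`), so `p_c ≤ sprinkleParam ≤ p + 100 p^{r+1} ≤ p + Cε`.
[cite: DuminilcopinKozmaTassion2020, Theorem 7 and §6] -/
theorem thm7_criticalProb_le (hd : 3 ≤ d) (p : unitInterval) {p_lo p_hi : ℝ} (hlo : 0 < p_lo)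
    (hlop : p_lo ≤ p) (hphi : (p : ℝ) ≤ p_hi) (hhi : p_hi < 1) {ε : ℝ} (hε0 : 0 < ε) (hε1 : ε ≤ 1)
    (hsmallT : 10 * (-Real.log (1 - p_hi)) * Fintype.card (HOct d) / p_lo * ε < 1)
    (hsmall : (3 * Real.exp (-(1 / ε)) + (2 * (1 / ε) ^ 2 + 2) *
        Real.exp (-((1 / ε) / Fintype.card (HOct d)))) * Real.exp ((1 / ε) / (2 * Fintype.card (HOct d))) ≤
        (1 - p_hi) / 128)
    {k K n N : ℕ} (hkK : k ≤ K) (hK1 : 1 ≤ K) (hKn : 10 * (K : ℝ) ≤ ε ^ 2 * n) (hnN : n < N)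
    (ha : ε ≤ (bondPercolation (zdGraph d) p).real (siteToBoundary d N))
    (hb : 1 - Real.exp (-(1 / ε)) ≤ (bondPercolation (zdGraph d) p).real
      (linkEvent (box d k) (innerBoundary (zdGraph d) (box d N)) N))
    (hc1 : (bondPercolation (zdGraph d) p).real (uniqZone (d := d) k K)ᶜ ≤ Real.exp (-(1 / ε)))
    (hc2 : (bondPercolation (zdGraph d) p).real (uniqZone (d := d) n N)ᶜ ≤ Real.exp (-(1 / ε))) :
    criticalProb (zdGraph d) (0 : Site d) ≤
      p + 1000 * (-Real.log (1 - p_hi)) * Fintype.card (HOct d) / p_lo * ε := by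
  haveI : NeZero d := ⟨by omega⟩
  have hκ1 : (1 : ℝ) ≤ Fintype.card (HOct d) := by exact_mod_cast Fintype.card_pos (α := HOct d)
  have hκ0 : (0 : ℝ) < Fintype.card (HOct d) := by linarith
  have hp0 : 0 < (p : ℝ) := hlo.trans_le hlop
  have hp1 : (p : ℝ) < 1 := hphi.trans_lt hhi
  have h1phi : 0 < 1 - p_hi := by linarith
  have hΛ0 : 0 < -Real.log (1 - p_hi) := by
    rw [neg_pos]; exact Real.log_neg h1phi (by linarith)
  -- the scales and Lemma 8
  have hscale := scales_fit hε0 hε1 hK1 hKn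
  have hKn' : K ≤ n := by
    have hKreal : (0 : ℝ) ≤ K := Nat.cast_nonneg K
    have hn0 : (0 : ℝ) ≤ n := Nat.cast_nonneg n
    have hε21 : ε ^ 2 ≤ 1 := by nlinarith
    have h1 : ε ^ 2 * (n : ℝ) ≤ 1 * n := mul_le_mul_of_nonneg_right hε21 hn0
    have : (K : ℝ) ≤ n := by linarith
    exact_mod_cast this
  have hmargin := margin_le hε0 hε1 hκ1
  set η : ℝ := (1 - (ε - Real.exp (-(1 / ε)))) ^ ⌈2 / ε ^ 2⌉₊ +
      (⌈2 / ε ^ 2⌉₊ + 1) * Real.exp (-(1 / ε)) ^ ((Fintype.card (HOct d) : ℝ))⁻¹ + Real.exp (-(1 / ε)) +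
      Real.exp (-(1 / ε)) with hηdef
  have hq0 : 0 < Real.exp (-(1 / ε)) := Real.exp_pos _
  have hqε : Real.exp (-(1 / ε)) ≤ ε / 2 := exp_neg_inv_le_half hε0
  have hη0 : 0 ≤ η := by
    have h1 : 0 ≤ (1 - (ε - Real.exp (-(1 / ε)))) ^ ⌈2 / ε ^ 2⌉₊ := pow_nonneg (by linarith) _
    have h2 : 0 ≤ ((⌈2 / ε ^ 2⌉₊ : ℝ) + 1) * Real.exp (-(1 / ε)) ^ ((Fintype.card (HOct d) : ℝ))⁻¹ := by
      positivity
    rw [hηdef]; linarith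
  -- the sprinkling window and `t`
  set T : ℝ := 10 * (-Real.log (1 - p_hi)) * Fintype.card (HOct d) / p_lo * ε with hT
  have hT0 : 0 < T := by positivity
  obtain ⟨m, hm1, hmT, hmlo⟩ := exists_pow_mem_window hlo hlop hp1 hT0 hsmallT
  have hx0 : 0 < (p : ℝ) ^ m := pow_pos hp0 m
  have hx1 : (p : ℝ) ^ m ≤ 1 := pow_le_one₀ hp0.le hp1.le
  have hxlo : 10 * (-Real.log (1 - p_hi)) * Fintype.card (HOct d) * ε ≤ (p : ℝ) ^ m := by
    have : p_lo * T = 10 * (-Real.log (1 - p_hi)) * Fintype.card (HOct d) * ε := by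
      rw [hT]; field_simp
    linarith
  obtain ⟨r, hr⟩ : ∃ r : ℕ, m = r + 1 := Nat.exists_eq_succ_of_ne_zero (by omega)
  have htge : 5 / (p : ℝ) ^ m ≤ (⌈5 / (p : ℝ) ^ m⌉₊ : ℕ) := Nat.le_ceil _
  have htle : ((⌈5 / (p : ℝ) ^ m⌉₊ : ℕ) : ℝ) < 5 / (p : ℝ) ^ m + 1 := Nat.ceil_lt_add_one (by positivity)
  have hfail := failure_le (t := ⌈5 / (p : ℝ) ^ m⌉₊) hphi (hp0.trans_le hphi) hhi hκ0 hε0 hη0 hmargin hsmall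
    hx0 hx1 hxlo htge htle
  rw [hr] at hfail
  -- the run
  let P : GMParams := ⟨d, hd, p, n, N, hnN, r⟩
  have hFC : ∀ S : Finset (Site P.d), S ⊆ box P.d P.k →
      (∀ ρ, ρ ≤ P.k → ∃ v ∈ S, P.supDist 0 v = ρ) →
      ∀ (a : Fin P.d) (τ : Fin P.d → ℤˣ),
        1 - η < (bondPercolation (zdGraph P.d) P.p).real (linkEvent S (orthantFace a τ P.n) P.n) := by
    intro S hS hmeet a τ
    have hmeet' : ∀ ρ, ρ ≤ n → ∃ v ∈ S, v ∈ innerBoundary (zdGraph d) (box d ρ) := by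
      intro ρ hρ
      obtain ⟨v, hv, hvρ⟩ := hmeet ρ hρ
      exact ⟨v, hv, mem_innerBoundary_of_supDist_eq P hvρ⟩
    have h := lemma8 p hkK hK1 hKn' hnN.le hscale ha hb hc1 hc2 hS hmeet' a τ
    have hlt : 1 - η < 1 - ((1 - (ε - Real.exp (-(1 / ε)))) ^ ⌈2 / ε ^ 2⌉₊ +
        (⌈2 / ε ^ 2⌉₊ + 1) * Real.exp (-(1 / ε)) ^ ((Fintype.card (HOct d) : ℝ))⁻¹ + Real.exp (-(1 / ε))) := by
      rw [hηdef]; linarith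
    exact hlt.trans_le h
  have hrun := P.criticalProb_le_sprinkleParam_of_sphereFC hη0 hFC hp0 hp1 _ hfail
  -- the sprinkled density
  have hsp := sprinkleParam_le p GMParams.L r
  have hL : (GMParams.L : ℝ) = 100 := by norm_num [GMParams.L]
  have hxT : (p : ℝ) ^ (r + 1) < T := by rw [← hr]; exact hmT
  calc criticalProb (zdGraph d) (0 : Site d) ≤ sprinkleParam p GMParams.L r := hrun
    _ ≤ p + GMParams.L * (p : ℝ) ^ (r + 1) := hsp
    _ = p + 100 * (p : ℝ) ^ (r + 1) := by rw [hL]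
    _ ≤ p + 100 * T := by linarith
    _ = p + 1000 * (-Real.log (1 - p_hi)) * Fintype.card (HOct d) / p_lo * ε := by
        rw [hT]; ring

end DKT20

end Literature.Probability.Percolation

end
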